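import Literature.MathematicalPhysics.QuantumFieldTheory.Balaban1983to89.B9Thm37GlueTorusCovSup

/-!
# Literature: Bałaban's propagators for lattice gauge theories [B9] — Δ_U of the solution: the SUP-NORM,
BLOCK-LOCALIZED form of Δ_U(Δ_U + a·Q_UᵀQ_U)⁻¹, uniform in the transport and in the volume (pv21 node
HOM-PU-COVLAP; MODEL)

Sources (bib keys):
* [B9] = `Balaban1985BackgroundPropagators` — T. Bałaban, *Propagators for lattice gauge theories in a background
  field*, Commun. Math. Phys. 99 (1985) 389–434.

THE PRINTED LOCI.  NO new «» span in this file.  Context, quoted or paraphrased in the headers of modules this file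
imports: [B9] (3.18)–(3.19) p. 393 (the one-step covariant averaging; `B9Thm37GlueTorusCov`), (3.3) pp. 390–391
(∇_U and its adjoint; `B9Thm37Glue`), (3.23)–(3.24) p. 394 (Δ′_a = Δ_U + Q′\*aQ′; `B9Thm37Glue`), and Theorem 3.1
with its display (3.42) p. 397 (`B9Thm37Glue`, `B9Thm37GlueTorusCovCT` v1.1, `B9Thm37GlueTorusCovSup` v1.1; the
directory's rendering `B9.KernelFamily` / `B9.pref4`): for y ∈ Λ_j, x ∈ Δ(y) and λ supported in Δ(y′) the four
quantities |(G′(U)λ)(x)|, |(∇_U G′(U)λ)(x)|, |(G′(U)∇\*_U λ)(x)|, |(Δ_U G′(U)λ)(x)| are at most B₀ times the scale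
prefactor (L^jη)², L^jη, L^jη, 1 respectively, times e^{−δ₀d(y,y′)}·|λ| (paraphrase, no quotation).  This file
concerns the SHAPE of the FOURTH entry — Δ_U of the solution, prefactor 1, evaluation localized to a cube — for
the lineage's one-step model.

THE POINT.  With G = (Δ_U + a·Q_UᵀQ_U)⁻¹ (a genuine two-sided inverse, `B9Thm37GlueTorusCov.mul_inverse_covLapCov`)
one has the IDENTITY Δ_U G f = f − a·Q_UᵀQ_U G f (`lap_inverse_apply`), and Q_UᵀQ_U is BLOCK-LOCAL with entries
of modulus ≤ w_max² (the transport matrices are isometries): |(Q_UᵀQ_U g)(p)| ≤ |Cp|²·w_max²·n·sup_{block of p₁}|g|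
for blocks of ≤ n sites (`abs_covMeanT_covMean_le` with `sum_block_le`).  Feeding the sup-norm localized decay of G
(`B9Thm37GlueTorusCovSup.sup_decay_torus`, p190426/p190532) at every site of the block of p₁:

* §1 (any comb) `abs_tr_le_one` (|tr(x)_{ki}| ≤ 1, from `Comb.tr_orth` and `B9Thm37GlueSz.abs_Rm_le_one`),
  `abs_covMean_le` (|(Q_U g)(β, i)| ≤ |w(β)|·Σ_{x ∈ β}Σ_j|g(x, j)|), `abs_covMeanT_covMean_le`,
  `sum_block_le` (a block sum of a field bounded by G₀ on the block is ≤ n·|Cp|·G₀), and the identity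
  `lap_inverse_apply`: (∇\*_U∇_U G f)(p) = f(p) − a·(Q_UᵀQ_U G f)(p);
* §2 THE TORUS (`UT N`, 1 ≤ M₀ ∣ N_i, cubic blocks of ≤ M₀^d sites by `B9Thm37GlueTorusCovPoinc.card_block_le`):
  **`lap_sup_decay_torus`**: for every isometric transport, all weights in the ranges of `sup_decay_torus`, every
  site set X, every f vanishing off X × Cp with |f| ≤ m, every point p and every R with R ≤ dist(x′, y) for all
  x′ ∈ X and ALL SITES y OF THE BLOCK OF p₁ (print's cube-level localization x ∈ Δ(y)):
  |(Δ_U G f)(p) − f(p)| ≤ a·|Cp|²·w_max²·M₀^d·B_T·e^{−(θ_T/2)·R}·m  (B_T = `supConst`, θ_T = `thetaTorus`);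
  **`lap_sup_bound_torus`** (X = everything, R = 0): ‖Δ_U G‖_{ℓ^∞ → ℓ^∞} ≤ 1 + a·|Cp|²·w_max²·M₀^d·B_T.
  All constants depend on (d, M₀, a, c_min, c_max, w_min, w_max, |Cp|) only — UNIFORM in the torus and in U.

HONEST SCOPE / NOT ASSERTED.  One averaging step on the unit lattice (print: the multiscale G′(U), weighted distance
d(y, y′), Hölder norms, regularity (3.35) with Mα₀ ≤ a₀, the side conditions M ≥ M₁ and a = 1, constants M₁, δ₀,
a₀, B₀ depending on d, L only) — print's Theorem 3.1 is neither asserted nor approximated; only the shape of its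
fourth pointwise entry is modelled, with the evaluation cube read as the block of p₁ and the crude constants of
`B9Thm37GlueTorusCovSup`.  The third entry (G′∇\*_U λ), the Hölder entries (3.43)–(3.45) and (3.46)–(3.47) are not
modelled in this file.  Here Δ_U denotes the model's ∇\*_U∇_U = `covDT ∘ covD` of `B9Thm37Glue` (bond weights c(b),
transport R(b)).  (v1.1 = DOCFIX, docstring-only: print's side conditions named, executing the cross-read of v1,
journal l.56325, GAPS C-adv6-87; all declarations and statements unchanged.)  value = kernel certificate (MODEL),
NOT summit progress; NOT continuum, NOT Clay.
-/

namespace Literature.MathematicalPhysics.QuantumFieldTheory.Balaban1983to89.B9Thm37GlueTorusCovLap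

noncomputable section

open Finset B9Thm37Glue B9Thm37GluePU B9Thm37GlueTorusCov B9Thm37GlueTorusCovPoinc B9Thm37GlueTorusCovCT
  B9Thm37GlueTorusCovSup
open B5TorusCover (UT Ctr)

/-! ## §1  Block locality of Q_UᵀQ_U and the identity Δ_U G = 1 − a·Q_UᵀQ_U G -/

section Generic

variable {St Cp B Bd : Type} {src tgt : Bd → St} (K : Comb src tgt B)

/-- The transport matrices of a comb with isometric bond matrices have entries of modulus ≤ 1. [folklore] -/
theorem abs_tr_le_one [Fintype Cp] [DecidableEq Cp] (Rm : Bd → Cp → Cp → ℝ)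
    (hRm : ∀ b i j, ∑ k, Rm b k i * Rm b k j = if i = j then (1 : ℝ) else 0) (x : St) (k i : Cp) :
    |K.tr Rm x k i| ≤ 1 :=
  B9Thm37GlueSz.abs_Rm_le_one (K.tr Rm) (K.tr_orth Rm hRm) x k i

/-- |(Q_U g)(β, i)| ≤ |w(β)|·Σ_{x : blk x = β} Σ_j |g(x, j)| for an isometric transport. [folklore] -/
theorem abs_covMean_le [Fintype St] [DecidableEq B] [Fintype Cp] [DecidableEq Cp] (w : B → ℝ)
    (Rm : Bd → Cp → Cp → ℝ) (hRm : ∀ b i j, ∑ k, Rm b k i * Rm b k j = if i = j then (1 : ℝ) else 0)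
    (g : St × Cp → ℝ) (q : B × Cp) :
    |covMean K w Rm g q| ≤ |w q.1| * ∑ x, if K.blk x = q.1 then ∑ j, |g (x, j)| else 0 := by
  rw [covMean_apply, abs_mul]
  refine mul_le_mul_of_nonneg_left ((Finset.abs_sum_le_sum_abs _ _).trans (Finset.sum_le_sum fun x _ => ?_))
    (abs_nonneg _)
  split_ifs with hx
  · refine (Finset.abs_sum_le_sum_abs _ _).trans (Finset.sum_le_sum fun j _ => ?_)
    rw [abs_mul]
    exact (mul_le_mul_of_nonneg_right (abs_tr_le_one K Rm hRm x q.2 j) (abs_nonneg _)).trans (by rw [one_mul])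
  · simp

/-- **Block locality of Q_UᵀQ_U**: |(Q_UᵀQ_U g)(p)| ≤ |Cp|·w_max²·Σ_{x : blk x = blk p₁} Σ_j |g(x, j)| whenever
|w| ≤ w_max and the transport is isometric. [folklore] -/
theorem abs_covMeanT_covMean_le [Fintype St] [DecidableEq B] [Fintype Cp] [DecidableEq Cp] (w : B → ℝ)
    {wmax : ℝ} (hw' : ∀ β, |w β| ≤ wmax) (Rm : Bd → Cp → Cp → ℝ)
    (hRm : ∀ b i j, ∑ k, Rm b k i * Rm b k j = if i = j then (1 : ℝ) else 0) (g : St × Cp → ℝ) (p : St × Cp) :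
    |covMeanT K w Rm (covMean K w Rm g) p| ≤
      Fintype.card Cp * wmax ^ 2 * ∑ x, if K.blk x = K.blk p.1 then ∑ j, |g (x, j)| else 0 := by
  have hw0 : 0 ≤ wmax := (abs_nonneg _).trans (hw' (K.blk p.1))
  have hS : 0 ≤ ∑ x, (if K.blk x = K.blk p.1 then ∑ j, |g (x, j)| else 0) :=
    Finset.sum_nonneg fun x _ => by split_ifs <;> [exact Finset.sum_nonneg fun j _ => abs_nonneg _; exact le_rfl]
  rw [covMeanT_apply]
  calc |∑ i, K.tr Rm p.1 i p.2 * (w (K.blk p.1) * covMean K w Rm g (K.blk p.1, i))|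
      ≤ ∑ i, |K.tr Rm p.1 i p.2 * (w (K.blk p.1) * covMean K w Rm g (K.blk p.1, i))| :=
        Finset.abs_sum_le_sum_abs _ _
    _ ≤ ∑ _i : Cp, wmax ^ 2 * ∑ x, (if K.blk x = K.blk p.1 then ∑ j, |g (x, j)| else 0) := by
        refine Finset.sum_le_sum fun i _ => ?_
        rw [abs_mul, abs_mul]
        have h1 : |K.tr Rm p.1 i p.2| ≤ 1 := abs_tr_le_one K Rm hRm p.1 i p.2
        have h2 : |w (K.blk p.1)| ≤ wmax := hw' _
        have h3 := abs_covMean_le K w Rm hRm g (K.blk p.1, i)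
        calc |K.tr Rm p.1 i p.2| * (|w (K.blk p.1)| * |covMean K w Rm g (K.blk p.1, i)|)
            ≤ 1 * (wmax * (wmax * ∑ x, if K.blk x = K.blk p.1 then ∑ j, |g (x, j)| else 0)) := by
              refine mul_le_mul h1 ?_ (mul_nonneg (abs_nonneg _) (abs_nonneg _)) zero_le_one
              refine mul_le_mul h2 (h3.trans ?_) (abs_nonneg _) hw0
              exact mul_le_mul_of_nonneg_right h2 hS
          _ = _ := by ring
    _ = _ := by rw [Finset.sum_const, Finset.card_univ, nsmul_eq_mul]; ring

/-- A block sum of a field bounded by G₀ on a block of ≤ n sites is ≤ n·|Cp|·G₀. [folklore] -/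
theorem sum_block_le [Fintype St] [DecidableEq B] [Fintype Cp] (blk : St → B) (β : B) {n : ℕ}
    (hn : (univ.filter fun x => blk x = β).card ≤ n) (g : St × Cp → ℝ) {G₀ : ℝ} (hG : 0 ≤ G₀)
    (hg : ∀ x, blk x = β → ∀ j, |g (x, j)| ≤ G₀) :
    ∑ x, (if blk x = β then ∑ j, |g (x, j)| else 0) ≤ n * (Fintype.card Cp * G₀) := by
  rw [← Finset.sum_filter]
  calc ∑ x ∈ univ.filter (fun x => blk x = β), ∑ j, |g (x, j)|
      ≤ ∑ _x ∈ univ.filter (fun x => blk x = β), (Fintype.card Cp : ℝ) * G₀ := by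
        refine Finset.sum_le_sum fun x hx => ?_
        have hxβ : blk x = β := (Finset.mem_filter.mp hx).2
        calc ∑ j, |g (x, j)| ≤ ∑ _j : Cp, G₀ := Finset.sum_le_sum fun j _ => hg x hxβ j
          _ = _ := by rw [Finset.sum_const, Finset.card_univ, nsmul_eq_mul]
    _ = (univ.filter fun x => blk x = β).card * (Fintype.card Cp * G₀) := by
        rw [Finset.sum_const, nsmul_eq_mul]
    _ ≤ _ := mul_le_mul_of_nonneg_right (by exact_mod_cast hn) (mul_nonneg (Nat.cast_nonneg _) hG)

/-- **The identity Δ_U G f = f − a·Q_UᵀQ_U G f** for G = (Δ_U + a·Q_UᵀQ_U)⁻¹ (two-sided inverse; isometric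
transport, all weights ≠ 0, a > 0). [cite: Balaban1985BackgroundPropagators, (3.23)–(3.24) p.394] -/
theorem lap_inverse_apply [Fintype St] [DecidableEq St] [Fintype Bd] [Fintype B] [DecidableEq B] [Fintype Cp]
    [DecidableEq Cp] (c : Bd → ℝ) (w : B → ℝ) (Rm : Bd → Cp → Cp → ℝ)
    (hRm : ∀ b i j, ∑ k, Rm b k i * Rm b k j = if i = j then (1 : ℝ) else 0) (hc : ∀ b, c b ≠ 0)
    (hw : ∀ β, w β ≠ 0) {a : ℝ} (ha : 0 < a) (f : St × Cp → ℝ) (p : St × Cp) :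
    covDT src tgt c Rm (covD src tgt c Rm (Ring.inverse (covLapCov K c w Rm a) f)) p =
      f p - a * covMeanT K w Rm (covMean K w Rm (Ring.inverse (covLapCov K c w Rm a) f)) p := by
  have h := mul_inverse_covLapCov K c w Rm hRm hc hw ha
  have h' := congrArg (fun T : Module.End ℝ (St × Cp → ℝ) => T f p) h
  simp only [Module.End.mul_apply, Module.End.one_apply] at h'
  generalize Ring.inverse (covLapCov K c w Rm a) f = g at h' ⊢
  unfold covLapCov at h'
  rw [LinearMap.add_apply, LinearMap.smul_apply, LinearMap.comp_apply, LinearMap.comp_apply, Pi.add_apply,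
    Pi.smul_apply, smul_eq_mul] at h'
  linarith

end Generic

/-! ## §2  The torus: Δ_U of the solution, block-localized, uniform in the volume and in the transport -/

section Torus

variable {d : ℕ} {N : Fin d → ℕ} [∀ i, NeZero (N i)] [NeZero d]

/-- **SUP-NORM, BLOCK-LOCALIZED DECAY OF Δ_U(Δ_U + a·Q_UᵀQ_U)⁻¹ ON EVERY TORUS, UNIFORM IN THE VOLUME AND IN THE
TRANSPORT (MODEL of the fourth pointwise entry of (3.42), scale prefactor 1).**  For every torus `UT N` with
1 ≤ M₀, M₀ ∣ N_i, every isometric transport (hRm), bond weights c_min ≤ |c(b)| ≤ c_max (c_min > 0), block weights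
w_min ≤ |w(z)| ≤ w_max (w_min > 0), a > 0, every site set X, every field f vanishing off X × Cp with |f| ≤ m, every
point p and every R with R ≤ dist(x′, y) for all x′ ∈ X and all sites y of the block of p₁:
|(Δ_U G f)(p) − f(p)| ≤ a·|Cp|²·w_max²·M₀^d·B_T·e^{−(θ_T/2)·R}·m, G = (Δ_U + a·Q_UᵀQ_U)⁻¹, B_T = `supConst …`,
θ_T = `thetaTorus …`. [cite: Balaban1985BackgroundPropagators, (3.42) p.397; (3.23)–(3.24) p.394; p.395] -/
theorem lap_sup_decay_torus {Cp : Type} [Fintype Cp] [DecidableEq Cp] {M₀ : ℕ} (hM : 1 ≤ M₀)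
    (hdiv : ∀ i, M₀ ∣ N i) (c : UT N × Fin d → ℝ) {cmin cmax : ℝ} (hcmin : 0 < cmin) (hc : ∀ b, cmin ≤ |c b|)
    (hc' : ∀ b, |c b| ≤ cmax) (w : Ctr N M₀ → ℝ) {wmin wmax : ℝ} (hwmin : 0 < wmin) (hw : ∀ β, wmin ≤ |w β|)
    (hw' : ∀ β, |w β| ≤ wmax) (Rm : UT N × Fin d → Cp → Cp → ℝ)
    (hRm : ∀ b i j, ∑ k, Rm b k i * Rm b k j = if i = j then (1 : ℝ) else 0) {a : ℝ} (ha : 0 < a)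
    (X : Finset (UT N)) (f : UT N × Cp → ℝ) (hfX : ∀ p', p'.1 ∉ X → f p' = 0) {m : ℝ}
    (hfm : ∀ p', |f p'| ≤ m) (p : UT N × Cp) {R : ℝ}
    (hR : ∀ x' ∈ X, ∀ y : UT N, tblk hM hdiv y = tblk hM hdiv p.1 → R ≤ dist x' y) :
    |covDT bsrc btgt c Rm (covD bsrc btgt c Rm (Ring.inverse (covLapCov (torusComb hM hdiv) c w Rm a) f)) p
        - f p| ≤
      a * ((Fintype.card Cp : ℝ) ^ 2 * wmax ^ 2 * (M₀ : ℝ) ^ d) *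
        (supConst d M₀ a wmin cmin cmax wmax (Fintype.card Cp) *
          Real.exp (-(thetaTorus d M₀ a wmin cmin cmax wmax / 2 * R)) * m) := by
  have hc0 : ∀ b, c b ≠ 0 := fun b h0 => by have := hc b; rw [h0, abs_zero] at this; linarith
  have hw0 : ∀ β, w β ≠ 0 := fun β h0 => by have := hw β; rw [h0, abs_zero] at this; linarith
  have hm : 0 ≤ m := (abs_nonneg _).trans (hfm p)
  have hB : 0 ≤ supConst d M₀ a wmin cmin cmax wmax (Fintype.card Cp) *
      Real.exp (-(thetaTorus d M₀ a wmin cmin cmax wmax / 2 * R)) * m :=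
    mul_nonneg (mul_nonneg (supConst_nonneg d M₀ ha hwmin cmin cmax wmax _) (Real.exp_pos _).le) hm
  -- the solution and its block-localized sup bound on the block of p₁
  have hG : ∀ y, (torusComb hM hdiv).blk y = (torusComb hM hdiv).blk p.1 → ∀ j,
      |Ring.inverse (covLapCov (torusComb hM hdiv) c w Rm a) f (y, j)| ≤
        supConst d M₀ a wmin cmin cmax wmax (Fintype.card Cp) *
          Real.exp (-(thetaTorus d M₀ a wmin cmin cmax wmax / 2 * R)) * m :=
    fun y hy j => sup_decay_torus hM hdiv c hcmin hc hc' w hwmin hw hw' Rm hRm ha X f hfX hfm (y, j)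
      (fun x' hx' => hR x' hx' y hy)
  have hcard : (univ.filter fun x => (torusComb hM hdiv).blk x = (torusComb hM hdiv).blk p.1).card ≤ M₀ ^ d :=
    card_block_le hM hdiv _
  rw [lap_inverse_apply (torusComb hM hdiv) c w Rm hRm hc0 hw0 ha f p, sub_sub_cancel_left, abs_neg, abs_mul,
    abs_of_pos ha]
  have h1 := abs_covMeanT_covMean_le (torusComb hM hdiv) w hw' Rm hRm
    (Ring.inverse (covLapCov (torusComb hM hdiv) c w Rm a) f) p
  have h2 := sum_block_le (Cp := Cp) (torusComb hM hdiv).blk ((torusComb hM hdiv).blk p.1) hcard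
    (Ring.inverse (covLapCov (torusComb hM hdiv) c w Rm a) f) hB hG
  have key : |covMeanT (torusComb hM hdiv) w Rm
      (covMean (torusComb hM hdiv) w Rm (Ring.inverse (covLapCov (torusComb hM hdiv) c w Rm a) f)) p| ≤
      Fintype.card Cp * wmax ^ 2 * ((M₀ ^ d : ℕ) * (Fintype.card Cp *
        (supConst d M₀ a wmin cmin cmax wmax (Fintype.card Cp) *
          Real.exp (-(thetaTorus d M₀ a wmin cmin cmax wmax / 2 * R)) * m))) :=
    h1.trans (mul_le_mul_of_nonneg_left h2 (mul_nonneg (Nat.cast_nonneg _) (sq_nonneg _)))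
  calc a * |covMeanT (torusComb hM hdiv) w Rm
          (covMean (torusComb hM hdiv) w Rm (Ring.inverse (covLapCov (torusComb hM hdiv) c w Rm a) f)) p|
      ≤ a * (Fintype.card Cp * wmax ^ 2 * ((M₀ ^ d : ℕ) * (Fintype.card Cp *
          (supConst d M₀ a wmin cmin cmax wmax (Fintype.card Cp) *
            Real.exp (-(thetaTorus d M₀ a wmin cmin cmax wmax / 2 * R)) * m)))) :=
        mul_le_mul_of_nonneg_left key ha.le
    _ = _ := by push_cast; ring

/-- **THE ℓ^∞ → ℓ^∞ OPERATOR NORM OF Δ_U(Δ_U + a·Q_UᵀQ_U)⁻¹ IS BOUNDED UNIFORMLY IN THE VOLUME AND IN THE TRANSPORT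
(MODEL; scale prefactor 1).**  |(Δ_U G f)(p)| ≤ (1 + a·|Cp|²·w_max²·M₀^d·B_T)·m whenever |f| ≤ m.
[cite: Balaban1985BackgroundPropagators, (3.42) p.397; (3.23)–(3.24) p.394; p.395] -/
theorem lap_sup_bound_torus {Cp : Type} [Fintype Cp] [DecidableEq Cp] {M₀ : ℕ} (hM : 1 ≤ M₀)
    (hdiv : ∀ i, M₀ ∣ N i) (c : UT N × Fin d → ℝ) {cmin cmax : ℝ} (hcmin : 0 < cmin) (hc : ∀ b, cmin ≤ |c b|)
    (hc' : ∀ b, |c b| ≤ cmax) (w : Ctr N M₀ → ℝ) {wmin wmax : ℝ} (hwmin : 0 < wmin) (hw : ∀ β, wmin ≤ |w β|)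
    (hw' : ∀ β, |w β| ≤ wmax) (Rm : UT N × Fin d → Cp → Cp → ℝ)
    (hRm : ∀ b i j, ∑ k, Rm b k i * Rm b k j = if i = j then (1 : ℝ) else 0) {a : ℝ} (ha : 0 < a)
    (f : UT N × Cp → ℝ) {m : ℝ} (hfm : ∀ p', |f p'| ≤ m) (p : UT N × Cp) :
    |covDT bsrc btgt c Rm (covD bsrc btgt c Rm (Ring.inverse (covLapCov (torusComb hM hdiv) c w Rm a) f)) p| ≤
      (1 + a * ((Fintype.card Cp : ℝ) ^ 2 * wmax ^ 2 * (M₀ : ℝ) ^ d) *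
        supConst d M₀ a wmin cmin cmax wmax (Fintype.card Cp)) * m := by
  have h := lap_sup_decay_torus hM hdiv c hcmin hc hc' w hwmin hw hw' Rm hRm ha univ f (fun p' h => absurd
    (mem_univ _) h) hfm p (R := 0) (fun x' _ y _ => dist_nonneg)
  rw [mul_zero, neg_zero, Real.exp_zero, mul_one] at h
  have h' := (abs_sub_abs_le_abs_sub _ _).trans h
  have hf := hfm p
  nlinarith [h', hf]

end Torus

end

end Literature.MathematicalPhysics.QuantumFieldTheory.Balaban1983to89.B9Thm37GlueTorusCovLap
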